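import Mathlib.Algebra.Order.BigOperators.Ring.Finset
import Mathlib.Algebra.Order.Floor.Ring
import Mathlib.Data.Int.Interval
import Mathlib.Data.Fintype.BigOperators
import Mathlib.Data.Matrix.Mul
import Mathlib.Data.Real.Basic
import Mathlib.Tactic
import HarnessLib

/-!
# Block psd lifts of the perfect matching polytope (cell pnp-psdrank, rung F-N2.SOC): the cube grid on the unit ball

Landing file 1b of 4 (pnp-psdrank-eng g4; work file HOME/pnp-psdrank-eng/lean/BlockLift.lean v2, sha256/16
01d03dbb37281499, Part B). The grid of side `1/L` on `[-1,1]^b`: a vector `v` with `v·v ≤ 1` lies in the cell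
`cell L v = (⌊L v_k⌋)_k ∈ {-L,…,L}^b = box b L` (`(2L+1)^b` cells) with centre `ctr L (cell L v)` at distance
`≤ √b/(2L)`; for `b ≤ L²` the distortion of a pairing is `(a·c − u·v)² ≤ 7b/(4L²)` (`u`, `v` the cell
centres). Feeds `netBall_dominated` / `core_at` (file `SmallBlockRothvossBallGridCore`) and the block bound
`2^{c n/(b+1)} ≤ m · n⁹` for every `(S^b_+)^m` psd lift of `P_PM(n)` (file `SmallBlockRothvossBallGridBound`).
WHAT THIS IS NOT: no statement about general psd rank (rung F-N2 stays open), nothing P ≠ NP-relevant.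
-/

set_option linter.dupNamespace false -- `Summit.PneNP.PneNP.…`: summit = sub-problem (D-0017)

noncomputable section

open Finset Real

namespace Summit.PneNP.PneNP.Theorems.SmallBlockRothvossBallGrid

section Grid

variable {b : ℕ}

/-- Grid cell of a vector: coordinatewise `⌊L · v_k⌋`. -/
def cell (L : ℕ) (v : Fin b → ℝ) : Fin b → ℤ := fun k => ⌊v k * L⌋

/-- Centre of a grid cell. -/
def ctr (L : ℕ) (z : Fin b → ℤ) : Fin b → ℝ := fun k => ((z k : ℝ) + 1 / 2) / L

/-- The box of cells met by the unit ball: `{-L, …, L}^b`. -/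
def box (b L : ℕ) : Finset (Fin b → ℤ) := Fintype.piFinset fun _ => Finset.Icc (-(L : ℤ)) L

/-- The box has `(2L+1)^b` cells. -/
theorem card_box (b L : ℕ) : ((box b L).card : ℝ) = (2 * L + 1 : ℝ) ^ b := by
  unfold box
  rw [Fintype.card_piFinset, prod_const, card_univ, Fintype.card_fin, Int.card_Icc]
  have : ((L : ℤ) + 1 - -(L : ℤ)).toNat = 2 * L + 1 := by omega
  rw [this]
  push_cast
  ring

/-- `0 ≤ v·v` for real vectors. -/
theorem dotProduct_self_nonneg_real (v : Fin b → ℝ) : 0 ≤ v ⬝ᵥ v :=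
  sum_nonneg fun i _ => mul_self_nonneg (v i)

/-- Cauchy–Schwarz with bounds: `u·u ≤ A`, `v·v ≤ C` give `(u·v)² ≤ A·C`. -/
theorem dotProduct_sq_le_mul {u v : Fin b → ℝ} {A C : ℝ} (hu : u ⬝ᵥ u ≤ A) (hv : v ⬝ᵥ v ≤ C) :
    (u ⬝ᵥ v) ^ 2 ≤ A * C := by
  have h := sum_mul_sq_le_sq_mul_sq univ u v
  have h' : (u ⬝ᵥ v) ^ 2 ≤ (u ⬝ᵥ u) * (v ⬝ᵥ v) := by
    unfold dotProduct
    simp only [← sq]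
    convert h using 3
  exact h'.trans (mul_le_mul hu hv (dotProduct_self_nonneg_real v) ((dotProduct_self_nonneg_real u).trans hu))

/-- `(u + v)·(u + v) ≤ 2 u·u + 2 v·v`. -/
theorem dotProduct_add_self_le (u v : Fin b → ℝ) :
    (u + v) ⬝ᵥ (u + v) ≤ 2 * (u ⬝ᵥ u) + 2 * (v ⬝ᵥ v) := by
  unfold dotProduct
  rw [mul_sum, mul_sum, ← sum_add_distrib]
  refine sum_le_sum fun i _ => ?_
  simp only [Pi.add_apply]
  nlinarith [sq_nonneg (u i - v i)]

/-- Vectors of norm `≤ 1` fall into the box. -/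
theorem cell_mem_box {L : ℕ} {v : Fin b → ℝ} (hv : v ⬝ᵥ v ≤ 1) : cell L v ∈ box b L := by
  unfold box cell
  rw [Fintype.mem_piFinset]
  intro k
  rw [Finset.mem_Icc]
  have hL : (0 : ℝ) ≤ L := Nat.cast_nonneg L
  have hvk : |v k| ≤ 1 := by
    have : v k * v k ≤ ∑ i, v i * v i :=
      single_le_sum (f := fun i => v i * v i) (fun i _ => mul_self_nonneg (v i)) (mem_univ k)
    unfold dotProduct at hv
    rw [← sq_le_one_iff_abs_le_one]
    nlinarith
  obtain ⟨hlo, hhi⟩ := abs_le.1 hvk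
  constructor
  · rw [Int.le_floor]
    push_cast
    nlinarith
  · have h1 : v k * L ≤ (L : ℝ) := by nlinarith
    have h2 := Int.floor_le_floor h1
    have h3 : ⌊((L : ℤ) : ℝ)⌋ = (L : ℤ) := Int.floor_intCast (L : ℤ)
    push_cast at h3
    rwa [h3] at h2

/-- Every coordinate is within `1/(2L)` of its cell centre. -/
theorem abs_sub_ctr_le {L : ℕ} (hL : 0 < L) (v : Fin b → ℝ) (k : Fin b) :
    |v k - ctr L (cell L v) k| ≤ 1 / (2 * L) := by
  unfold ctr cell
  have hL' : (0 : ℝ) < L := by exact_mod_cast hL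
  have h1 := Int.floor_le (v k * L)
  have h2 := Int.lt_floor_add_one (v k * L)
  have hx : |v k * L - ⌊v k * L⌋ - 1 / 2| ≤ 1 / 2 := by
    rw [abs_le]; constructor <;> linarith
  have heq : v k - ((⌊v k * L⌋ : ℝ) + 1 / 2) / L = (v k * L - ⌊v k * L⌋ - 1 / 2) / L := by
    field_simp
    ring
  rw [heq, abs_div, abs_of_pos hL']
  calc |v k * L - ⌊v k * L⌋ - 1 / 2| / L ≤ (1 / 2) / L := div_le_div_of_nonneg_right hx hL'.le
    _ = 1 / (2 * L) := by field_simp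

/-- The squared distance to the cell centre is at most `b/(4L²)`. -/
theorem sub_ctr_sq_le {L : ℕ} (hL : 0 < L) (v : Fin b → ℝ) :
    (v - ctr L (cell L v)) ⬝ᵥ (v - ctr L (cell L v)) ≤ b / (4 * (L : ℝ) ^ 2) := by
  have hL' : (0 : ℝ) < L := by exact_mod_cast hL
  unfold dotProduct
  calc ∑ k, (v - ctr L (cell L v)) k * (v - ctr L (cell L v)) k
      ≤ ∑ _k : Fin b, (1 / (2 * (L : ℝ))) ^ 2 := by
        refine sum_le_sum fun k _ => ?_
        have h := abs_sub_ctr_le hL v k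
        have h0 : 0 ≤ |v k - ctr L (cell L v) k| := abs_nonneg _
        simp only [Pi.sub_apply]
        rw [← sq, ← sq_abs]
        exact pow_le_pow_left₀ h0 h 2
    _ = b / (4 * (L : ℝ) ^ 2) := by
        rw [sum_const, card_univ, Fintype.card_fin, nsmul_eq_mul]
        field_simp
        ring

/-- **The grid distortion.** For `a·a ≤ 1`, `c·c ≤ 1` and `b ≤ L²` (so cells have radius `≤ 1/2`), with
cell centres `u`, `v`: `(a·c − u·v)² ≤ 7b/(4L²)`. -/
theorem distortion_sq_le {L : ℕ} (hL : 0 < L) (hbL : b ≤ L ^ 2) {a c : Fin b → ℝ}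
    (ha : a ⬝ᵥ a ≤ 1) (hc : c ⬝ᵥ c ≤ 1) :
    (a ⬝ᵥ c - ctr L (cell L a) ⬝ᵥ ctr L (cell L c)) ^ 2 ≤ 7 * b / (4 * (L : ℝ) ^ 2) := by
  have hL' : (0 : ℝ) < L := by exact_mod_cast hL
  set u := ctr L (cell L a) with hu
  set v := ctr L (cell L c) with hv
  set wsq : ℝ := b / (4 * (L : ℝ) ^ 2) with hwsq
  have hwsq0 : 0 ≤ wsq := by positivity
  have hwsq4 : wsq ≤ 1 / 4 := by
    rw [hwsq, div_le_div_iff₀ (by positivity) (by norm_num)]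
    have : (b : ℝ) ≤ (L : ℝ) ^ 2 := by exact_mod_cast hbL
    linarith
  have hau : (a - u) ⬝ᵥ (a - u) ≤ wsq := sub_ctr_sq_le hL a
  have hcv : (c - v) ⬝ᵥ (c - v) ≤ wsq := sub_ctr_sq_le hL c
  -- `u·u ≤ 2 + 2 wsq`
  have huu : u ⬝ᵥ u ≤ 2 + 2 * wsq := by
    have h1 := dotProduct_add_self_le a (u - a)
    have h2 : a + (u - a) = u := by abel
    rw [h2] at h1
    have h3 : (u - a) ⬝ᵥ (u - a) = (a - u) ⬝ᵥ (a - u) := by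
      have : u - a = -(a - u) := by abel
      rw [this, neg_dotProduct, dotProduct_neg, neg_neg]
    rw [h3] at h1
    linarith
  -- split `a·c − u·v = (a − u)·c + u·(c − v)`
  have hsplit : a ⬝ᵥ c - u ⬝ᵥ v = (a - u) ⬝ᵥ c + u ⬝ᵥ (c - v) := by
    rw [sub_dotProduct, dotProduct_sub]; ring
  have e1 : ((a - u) ⬝ᵥ c) ^ 2 ≤ wsq * 1 := dotProduct_sq_le_mul hau hc
  have e2 : (u ⬝ᵥ (c - v)) ^ 2 ≤ (2 + 2 * wsq) * wsq := dotProduct_sq_le_mul huu hcv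
  rw [hsplit]
  have h7 : 7 * b / (4 * (L : ℝ) ^ 2) = 7 * wsq := by rw [hwsq]; ring
  rw [h7]
  nlinarith [sq_nonneg ((a - u) ⬝ᵥ c - u ⬝ᵥ (c - v))]

end Grid

end Summit.PneNP.PneNP.Theorems.SmallBlockRothvossBallGrid

end
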